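import Mathlib
import Summits.NavierStokesRegularity.NavierStokesRegularity.Theorems.EulerZoomLiouvillePowerGaugeEulerLiouvilleSmallMomentLaw
import HarnessLib

/-!
# THE VORTICITY CEILING IN MEASURE (nsreg-p2 ROUND-54 «THE TRACE», plate t59-CEIL: `NsregP2.R54.Trace.VorticityCeilingLaw ρ V` VERBATIM, r54/Sketch54.lean f78682d2f4ee3f27;
# seat ns-ezl-w3 g8, `--supports stmt-NavierStokesRegularity-19832 --as helper`)

For a `C²` self-similar Euler profile (`γ = 1/(2+ρ)`, centre `0`, `0 < ρ < 1`) of the budget class and every `ε > 0` there is a level `M` with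
`vol{y ∈ B_R : ‖curl V(y)‖ > M·R^{−(2+ρ)}} ≤ ε·R³` for all `R ≥ 1`: vorticity does NOT exceed the borderline size on any positive fraction of a large ball —
the CEILING matching THE FLOOR's `MomentFloor.BorderlineVorticityDensity` (R53 F4).  Proof = CHEBYSHEV on R52 §E (ns-sfl-p1 g9's `SmallMoment.smallMomentLaw`
at `2p = ½`): `(M R^{−(2+ρ)})^{1/2}·vol ≤ ∫_{B_R}‖Ω‖^{1/2} ≤ C·R^{3−(2+ρ)/2}`, so `vol ≤ C·M^{−1/2}·R³`, and `M = (C/ε)² + 1`.  (The planner's Lagrangian route —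
inflow + mean strain + Grönwall + Jacobian — proves more, a ceiling along trajectories; the typed text needs only the upper moment law.)

* ★ `VorticityCeiling.vorticityCeilingLaw (hρ : 0 < ρ) (hρ1 : ρ < 1) (V)` = `NsregP2.R54.Trace.VorticityCeilingLaw ρ V` VERBATIM.

HONEST FRAMING: a portrait statement about HYPOTHETICAL profiles (instrument-level; with R53 F4: IN MEASURE `‖Ω‖ ≍ ‖y‖^{−(2+ρ)}` on large balls); nothing about the crux E
(`PowerGaugeEulerLiouville`, stmt 19832, OPEN) or NS regularity is proved; MODEL-lattice crux class; not E. [nsreg-p2 R54 §C; folklore (Chebyshev)]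
-/

noncomputable section

set_option linter.dupNamespace false

open MeasureTheory Set Filter Topology Metric Function TopologicalSpace
open scoped ENNReal NNReal RealInnerProductSpace Topology

namespace Summit.NavierStokesRegularity.NavierStokesRegularity.Theorems.PowerGaugeEulerLiouville

open Literature.Analysis Literature.Analysis.FluidPDE

namespace VorticityCeiling

/-- ★ **t59-CEIL: `NsregP2.R54.Trace.VorticityCeilingLaw ρ V` VERBATIM** (`0 < ρ < 1`): for every `ε > 0` there are `M, R₀` with
`vol{y ∈ B_R : M·R^{−(2+ρ)} < ‖curl V y‖} ≤ ε·R³` for all `R ≥ R₀` — Chebyshev on the small-moment law at order `½`. [nsreg-p2 R54 §C; folklore] -/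
theorem vorticityCeilingLaw {ρ : ℝ} (hρ : 0 < ρ) (hρ1 : ρ < 1) (V : EuclideanSpace ℝ (Fin 3) → EuclideanSpace ℝ (Fin 3)) :
    ∀ P : EuclideanSpace ℝ (Fin 3) → ℝ, IsSelfSimilarEulerProfile (1 / (2 + ρ)) 0 V P →
      (∫⁻ y, ‖fderiv ℝ V y‖ₑ ^ 2 * ENNReal.ofReal (‖y‖ ^ (ρ - 1))) ≠ ⊤ →
      (∃ A : ℝ, ∀ R : ℝ, 1 ≤ R → ∫ y in ball (0 : EuclideanSpace ℝ (Fin 3)) R, ‖V y‖ ^ 2 ≤ A * R ^ (1 - 2 * ρ)) →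
      ∀ ε : ℝ, 0 < ε → ∃ M R₀ : ℝ, ∀ R : ℝ, R₀ ≤ R →
        (volume {y ∈ ball (0 : EuclideanSpace ℝ (Fin 3)) R | M * R ^ (-(2 + ρ)) < ‖curl V y‖}).toReal ≤ ε * R ^ (3 : ℝ) := by
  intro P hprof hE hA ε hε
  have hV2 : ContDiff ℝ 2 V := hprof.contDiff_velocity
  have hΩc : Continuous (curl V) := (contDiff_curl (n := 1) (by exact_mod_cast hV2)).continuous
  -- the upper law at `2p = 1/2`
  obtain ⟨C, hC⟩ := SmallMoment.smallMomentLaw hρ hρ1 V P hprof (1 / 4) (by norm_num) (by norm_num) hE hA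
  have hC0 : 0 ≤ C := by
    have h := hC 1 le_rfl
    rw [Real.one_rpow, mul_one] at h
    exact (integral_nonneg fun y => Real.rpow_nonneg (norm_nonneg _) _).trans h
  set M : ℝ := (C / ε) ^ 2 + 1 with hMdef
  have hM0 : 0 < M := by positivity
  have hMroot : C / ε ≤ M ^ (1 / 2 : ℝ) := by
    have h1 : ((C / ε) ^ 2) ^ (1 / 2 : ℝ) ≤ M ^ (1 / 2 : ℝ) :=
      Real.rpow_le_rpow (sq_nonneg _) (by rw [hMdef]; linarith) (by norm_num)
    have h2 : ((C / ε) ^ 2) ^ (1 / 2 : ℝ) = C / ε := by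
      rw [show ((C / ε) ^ 2 : ℝ) = (C / ε) ^ (2 : ℝ) by rw [Real.rpow_two], ← Real.rpow_mul (div_nonneg hC0 hε.le)]
      norm_num
    linarith
  have hCM : C * M ^ (-(1 / 2 : ℝ)) ≤ ε := by
    rw [Real.rpow_neg hM0.le]
    have hMr : 0 < M ^ (1 / 2 : ℝ) := Real.rpow_pos_of_pos hM0 _
    rw [mul_inv_le_iff₀ hMr]
    have := (div_le_iff₀ hε).1 hMroot
    linarith
  refine ⟨M, 1, fun R hR => ?_⟩
  have hR0 : 0 < R := by linarith
  set t : ℝ := M * R ^ (-(2 + ρ)) with htdef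
  have ht0 : 0 < t := mul_pos hM0 (Real.rpow_pos_of_pos hR0 _)
  -- Chebyshev on `B_R` for `f = ‖Ω‖^{1/2}` at the level `t^{1/2}`
  set μ : Measure (EuclideanSpace ℝ (Fin 3)) := volume.restrict (ball (0 : EuclideanSpace ℝ (Fin 3)) R) with hμ
  have hint : Integrable (fun y => ‖curl V y‖ ^ (1 / 2 : ℝ)) μ :=
    ((hΩc.norm.rpow_const fun _ => Or.inr (by norm_num)).continuousOn.integrableOn_compact
      (isCompact_closedBall (0 : EuclideanSpace ℝ (Fin 3)) R)).mono_set ball_subset_closedBall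
  have hcheb := mul_meas_ge_le_integral_of_nonneg (μ := μ) (ae_of_all _ fun y => Real.rpow_nonneg (norm_nonneg (curl V y)) (1 / 2 : ℝ))
    hint (t ^ (1 / 2 : ℝ))
  -- the superlevel set sits inside the Chebyshev set
  have hTm : MeasurableSet {y : EuclideanSpace ℝ (Fin 3) | t ^ (1 / 2 : ℝ) ≤ ‖curl V y‖ ^ (1 / 2 : ℝ)} :=
    (isClosed_le continuous_const (hΩc.norm.rpow_const fun _ => Or.inr (by norm_num))).measurableSet
  have hsub : {y ∈ ball (0 : EuclideanSpace ℝ (Fin 3)) R | M * R ^ (-(2 + ρ)) < ‖curl V y‖} ⊆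
      {y : EuclideanSpace ℝ (Fin 3) | t ^ (1 / 2 : ℝ) ≤ ‖curl V y‖ ^ (1 / 2 : ℝ)} ∩ ball (0 : EuclideanSpace ℝ (Fin 3)) R := by
    intro y hy
    exact ⟨Real.rpow_le_rpow ht0.le (le_of_lt hy.2) (by norm_num), hy.1⟩
  have hvol : (volume {y ∈ ball (0 : EuclideanSpace ℝ (Fin 3)) R | M * R ^ (-(2 + ρ)) < ‖curl V y‖}).toReal ≤
      μ.real {y : EuclideanSpace ℝ (Fin 3) | t ^ (1 / 2 : ℝ) ≤ ‖curl V y‖ ^ (1 / 2 : ℝ)} := by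
    rw [hμ, measureReal_restrict_apply hTm, ← measureReal_def]
    exact measureReal_mono hsub (measure_ne_top_of_subset inter_subset_right measure_ball_lt_top.ne)
  -- `t^{1/2}·vol ≤ ∫_{B_R}‖Ω‖^{1/2} ≤ C R^{3 − (2+ρ)/2}`
  have hup : ∫ y in ball (0 : EuclideanSpace ℝ (Fin 3)) R, ‖curl V y‖ ^ (1 / 2 : ℝ) ≤ C * R ^ (3 - (2 + ρ) / 2) := by
    have h := hC R hR
    have e1 : (2 : ℝ) * (1 / 4) = 1 / 2 := by norm_num
    have e2 : (3 : ℝ) - 1 / 2 * (2 + ρ) = 3 - (2 + ρ) / 2 := by ring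
    rw [e1, e2] at h
    exact h
  have htroot : t ^ (1 / 2 : ℝ) = M ^ (1 / 2 : ℝ) * R ^ (-(2 + ρ) / 2) := by
    rw [htdef, Real.mul_rpow hM0.le (Real.rpow_nonneg hR0.le _), ← Real.rpow_mul hR0.le]
    congr 2; ring
  have htr0 : 0 < t ^ (1 / 2 : ℝ) := Real.rpow_pos_of_pos ht0 _
  have hkey : t ^ (1 / 2 : ℝ) * μ.real {y : EuclideanSpace ℝ (Fin 3) | t ^ (1 / 2 : ℝ) ≤ ‖curl V y‖ ^ (1 / 2 : ℝ)} ≤ C * R ^ (3 - (2 + ρ) / 2) :=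
    hcheb.trans hup
  -- divide and simplify: `vol ≤ C M^{−1/2} R³ ≤ ε R³`
  have e : C * R ^ (3 - (2 + ρ) / 2) = t ^ (1 / 2 : ℝ) * (C * M ^ (-(1 / 2 : ℝ)) * R ^ (3 : ℝ)) := by
    rw [htroot]
    have hM1 : M ^ (-(1 / 2 : ℝ)) * M ^ (1 / 2 : ℝ) = 1 := by
      rw [← Real.rpow_add hM0]; norm_num
    have hR1 : R ^ (3 : ℝ) * R ^ (-(2 + ρ) / 2) = R ^ (3 - (2 + ρ) / 2) := by
      rw [← Real.rpow_add hR0]; congr 1; ring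
    calc C * R ^ (3 - (2 + ρ) / 2) = C * (M ^ (-(1 / 2 : ℝ)) * M ^ (1 / 2 : ℝ)) * (R ^ (3 : ℝ) * R ^ (-(2 + ρ) / 2)) := by
          rw [hM1, hR1]; ring
      _ = M ^ (1 / 2 : ℝ) * R ^ (-(2 + ρ) / 2) * (C * M ^ (-(1 / 2 : ℝ)) * R ^ (3 : ℝ)) := by ring
  have hvol2 : μ.real {y : EuclideanSpace ℝ (Fin 3) | t ^ (1 / 2 : ℝ) ≤ ‖curl V y‖ ^ (1 / 2 : ℝ)} ≤ C * M ^ (-(1 / 2 : ℝ)) * R ^ (3 : ℝ) := by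
    rw [e] at hkey
    exact le_of_mul_le_mul_left hkey htr0
  calc (volume {y ∈ ball (0 : EuclideanSpace ℝ (Fin 3)) R | M * R ^ (-(2 + ρ)) < ‖curl V y‖}).toReal
      ≤ C * M ^ (-(1 / 2 : ℝ)) * R ^ (3 : ℝ) := hvol.trans hvol2
    _ ≤ ε * R ^ (3 : ℝ) := mul_le_mul_of_nonneg_right hCM (Real.rpow_nonneg hR0.le _)

end VorticityCeiling

end Summit.NavierStokesRegularity.NavierStokesRegularity.Theorems.PowerGaugeEulerLiouville

end
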